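import Mathlib
import Summits.QuantumAdvantage.QuantumAdvantage.Theorems.MobiusLadderLiouvilleNotAC0Xor
import Literature.Computability.MetaComplexity.SmolenskyRows

/-!
# The cube-form correlation of a low-degree function is a crux-form correlation

Helper for line Sketch/LAR of crux stmt-QuantumAdvantage-1392 (wave 2, support; the crux implies
LAR at polylog levels). For a function `h ∈ lowDeg 𝔽₂ n k` on the cube `{0,1}ⁿ` (the span of the
multilinear monomials `x_S`, `|S| ≤ k`), the cube-form correlation of the Liouville function with
the phase of `h`,

  `Σ_{b ∈ {0,1}ⁿ} λ(val b) · (−1)^{[h b = 1]}`     (`val b = boolFunEquivFin n b`),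

equals the crux-form (range/testBit/MvPolynomial) correlation

  `Σ_{N < 2ⁿ} λ(N) · (−1)^{[P(bits N) = 1]}`

of an honest polynomial `P ∈ 𝔽₂[x_0, …, x_{n-1}]` of total degree `≤ k`. Proof: take `P` with
`P(b) = h b` on the cube (`exists_mvPolynomial_of_mem_lowDeg`), reindex `N = val b` through the
enumeration `boolFunEquivFin n : {0,1}ⁿ ≃ Fin 2ⁿ`, and use that the digits of `val b` are `b`
(`testBit_boolFunEquivFin`).
-/

namespace Summit.QuantumAdvantage.DigitPolyUniformity.SketchLAR

open Finset Module
open Literature.Computability.MetaComplexity (boolFunEquivFin)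
open Literature.Computability.MetaComplexity.Smolensky (CubeFn mono lowDeg)

namespace CorrCubeOfRange

/-- **Reindexing a digit sum over the cube**: for any `g : ℕ → ℝ`,
`Σ_{N < 2ⁿ} g N = Σ_{b ∈ {0,1}ⁿ} g (val b)` through the enumeration `boolFunEquivFin n`.
[folklore] -/
theorem sum_range_eq_sum_cube {n : ℕ} (g : ℕ → ℝ) :
    ∑ N ∈ range (2 ^ n), g N = ∑ b : Fin n → Bool, g ((boolFunEquivFin n b : Fin (2 ^ n)) : ℕ) := by
  rw [← Fin.sum_univ_eq_sum_range]
  exact (Equiv.sum_comp (boolFunEquivFin n) (fun k : Fin (2 ^ n) => g (k : ℕ))).symm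

end CorrCubeOfRange

/-- **Cube form = crux form.** For `h ∈ lowDeg 𝔽₂ n k` there is a polynomial `P` over `𝔽₂` of
total degree `≤ k` with
`Σ_b λ(val b)(−1)^{[h b = 1]} = Σ_{N<2^n} λ(N)(−1)^{[P(bits N) = 1]}`
(choose `P` agreeing with `h` on the cube, `exists_mvPolynomial_of_mem_lowDeg`; reindex
`N = val b` via `boolFunEquivFin`, whose digits are `b`). [folklore] -/
theorem stub_corr_cube_of_range {n k : ℕ} (h : CubeFn (ZMod 2) n) (hh : h ∈ lowDeg (ZMod 2) n k) :
    ∃ P : MvPolynomial (Fin n) (ZMod 2), P.totalDegree ≤ k ∧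
      ∑ b : Fin n → Bool, ((ArithmeticFunction.liouville ((boolFunEquivFin n b : Fin (2 ^ n)) : ℕ) : ℤ) : ℝ) *
          (if h b = 1 then (-1 : ℝ) else 1) =
        ∑ N ∈ range (2 ^ n), ((ArithmeticFunction.liouville N : ℤ) : ℝ) *
          (if MvPolynomial.eval (fun i : Fin n => if Nat.testBit N i then (1 : ZMod 2) else 0) P = 1
            then (-1 : ℝ) else 1) := by
  obtain ⟨P, hPdeg, hPeval⟩ :=
    Summit.QuantumAdvantage.QuantumAdvantage.Theorems.MobiusLadder.exists_mvPolynomial_of_mem_lowDeg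
      hh
  refine ⟨P, hPdeg, ?_⟩
  -- the crux-form summand as a function of `N`
  set g : ℕ → ℝ := fun N => ((ArithmeticFunction.liouville N : ℤ) : ℝ) *
      (if MvPolynomial.eval (fun i : Fin n => if Nat.testBit N i then (1 : ZMod 2) else 0) P = 1
        then (-1 : ℝ) else 1) with hg
  -- reindex the right side over the cube and compare pointwise
  rw [CorrCubeOfRange.sum_range_eq_sum_cube g]
  refine Finset.sum_congr rfl fun b _ => ?_
  -- the digits of `val b` are `b`, so the evaluation point is `b` itself and `P(b) = h b`
  have hpt : (fun i : Fin n => if Nat.testBit ((boolFunEquivFin n b : Fin (2 ^ n)) : ℕ) i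
      then (1 : ZMod 2) else 0) = fun i => if b i then (1 : ZMod 2) else 0 :=
    funext fun i => by
      rw [Literature.Computability.MetaComplexity.Smolensky.testBit_boolFunEquivFin]
  simp only [hg]
  rw [hpt, hPeval b]

end Summit.QuantumAdvantage.DigitPolyUniformity.SketchLAR
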